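import Literature.NumberTheory.Automorphic.UnitaryGroupTransferAway
import Literature.NumberTheory.Automorphic.HermitianFormAnisotropicPlacesFinite
import HarnessLib

/-!
# Global transfer of test functions away from the bad places with local identifications given only OFF a finite set `S`
# (`GlobalTransferAwayOff`), and the rank-2 supply of such a family off the anisotropic set `T`
(Rogawski, *Automorphic representations of unitary groups in three variables* (1990), §14.2 pp. 232–233; §3.8 p. 30)

Topic `NumberTheory/Automorphic`; namespace `Literature.NumberTheory.Automorphic.UnitaryGroup`.  TWO definitions with bodies (RELATIONS between test
functions on two forms — nothing is asserted), the rest proved theorems; no named fact, no `sorry`, no instance, no notation.  Rank-GENERIC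
sequel of ★ `UnitaryGroupTransferAway` (`GlobalTransferAway ψ S₀ f′ f` for a TOTAL family `ψ : ∀ v, U(H)(L⁺_v) ≃ₜ* U(H′)(L⁺_v)`).

**Why (cell `hodgecm-mathlib`, the `N = 2` edition of the quasi-split comparison letter T1g(N, H); F0P3a SPEC-ed1.19c §7, director D1 s465).**
In rank `3` a total family `ψ` exists for every anisotropic inner form (★ `exists_psi_forall_levelMatching`: odd rank).  In rank `2` it does NOT:
at a place `v` of the finite anisotropic set `T` of the plane `H` the type `U(H)(L⁺_v) ≃ₜ* U(Φ₂)(L⁺_v)` is empty (★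
`isEmpty_cmDatum_local_equiv_antidiagTwo_of_not_isIsotropic`, compact vs non-compact), and `T ≠ ∅` is forced when `[L⁺:ℚ]` is even (★
`isEmpty_forall_cmDatum_local_equiv_antidiagTwo_of_even_finrank`).  Rogawski's «for `v ∉ S₀ ∪ S` … we identify `G′_v` and `G_v` … `f_v = f′_v`»
[§14.2 p. 233] only ever USES `ψ_v` for `v ∉ S`, so the honest rank-generic object takes the identifications as a family DEFINED OFF `S`:
`ψ : ∀ v, v ∉ S → U(H)(L⁺_v) ≃ₜ* U(H′)(L⁺_v)`.  With `S = ∅` it is the ★ object (`globalTransferAwayOff_empty_iff`), so the `N = 3` line is untouched.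
Consumed by F0P3a's `N = 2` edition (SPEC-ed1.19c §7 T1g(2,H), the «`v ∉ S`» half; F0P5-plan (g2) desk word #12 «D1 GO»); the «`v ∈ S`» half
(`S ⊇ T`: the local inner-transfer datum at the anisotropic places, (α)∕(β) of director s465∕s476) is NOT this file.

* §1 **(D) `LocalTransferAwayOff S ψ T T′ S₀bad`** (`T′.loc v = T.loc v ∘ (ψ v hv)⁻¹` for `v ∉ S`, `v ∉ S₀bad`) and **`GlobalTransferAwayOff S ψ S₀ f′ f`**
  (`f′`, `f` pure tensors matching along `ψ` off `S ∪ S₀` and their own bad sets); `_iff` unfoldings; the bridges `localTransferAwayOff_empty_iff`,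
  `globalTransferAwayOff_empty_iff` to the ★ total-family relations.
* §2 **(N) non-vacuity** `exists_globalTransferAwayOff_ne_zero`: if the `ψ v hv` match the integral levels for `v ∉ S ∪ S₀`, the unit tensors
  `φ_∞ ⊗ ⊗_v 1_{U(𝒪_v)}` on both sides are related and `f′ ≠ 0` (twin of ★ `exists_globalTransferAway_ne_zero`).
* §3 **(Ψ₂) the rank-2 supply** `exists_psiOff_conj_forall_levelMatching_two`: for `H ∈ M₂(L)` hermitian, `det H ≠ 0`: a `Finset` `S` with `↑S = T`
  (the anisotropic places, finite by ★ `finite_setOf_not_isIsotropic_standingData`), ONE family `ψ : ∀ v, v ∉ S → U(H)(L⁺_v) ≃ₜ* U(Φ₂)(L⁺_v)` that is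
  CONJUGATION at every `v ∉ S` (hence `γ′ ↔ ψ_v γ′`, `ψ_v⁻¹ γ ↔ γ`), and a finite `S₀ ⊇ S` off which it matches the integral levels — glued by
  `dite` from ★ `exists_finset_rankTwo_levelMatching`, exactly as ★ `exists_psi_conj_forall_levelMatching` glues in rank `3`; and
  `exists_psiOff_globalTransferAwayOff_ne_zero_two` — with that family, `GlobalTransferAwayOff` is non-vacuous.

HONEST LABEL: HC_CM is proved only modulo the printed citations until rung 0 closes; this file is unconditional and proves no cell binder.

## References
* [Rogawski1990] J. Rogawski, Ann. of Math. Stud. 123 (1990), §14.2 pp. 232–233 (`ψ`, `K_v ≃ K′_v`, `f_v = f′_v` off `S₀ ∪ S`), §3.8 p. 30.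
* [BorelJacquet1979] A. Borel, H. Jacquet, PSPM 33.1 (1979), §4.1 (factorizable functions on `G(𝔸)`).
-/

set_option autoImplicit false

noncomputable section

open NumberField IsDedekindDomain Filter Set
open Literature.NumberTheory.Rogawski1990 (Corresponds)
open scoped Classical Matrix MatrixGroups

namespace Literature.NumberTheory.Automorphic.UnitaryGroup

variable (L : Type) [Field L] [NumberField L] [IsCMField L] (N : ℕ)

/-! ## §1 (D) Transfer away from the bad places along a family defined off `S` -/

/-- **`LocalTransferAwayOff S ψ T T′ S₀bad` — `f′_v = f_v ∘ ψ_v⁻¹` off `S` and off the bad places**: for local identifications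
`ψ v hv : U(H)(L⁺_v) ≃ₜ* U(H′)(L⁺_v)` given only for `v ∉ S` and pure tensors `T` on `U(H)`, `T′` on `U(H′)`: for every `v ∉ S` with `v ∉ S₀bad`,
`T′.loc v = T.loc v ∘ (ψ v hv)⁻¹` — [Rogawski1990, §14.2 p. 233] «for `v ∉ S₀ ∪ S` … `f_v = f′_v`», with the identifications carried exactly where print
uses them.  A RELATION; nothing at `S`, at the bad places or at infinity. [cite: Rogawski1990, §14.2 p. 233] -/
def LocalTransferAwayOff {H H' : Matrix (Fin N) (Fin N) L} (S : Finset (HeightOneSpectrum (𝓞 ↥(maximalRealSubfield L))))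
    (ψ : ∀ v : HeightOneSpectrum (𝓞 ↥(maximalRealSubfield L)), v ∉ S → ((cmDatum L N H).Local v ≃ₜ* (cmDatum L N H').Local v))
    (T : PureTensor L N H) (T' : PureTensor L N H') (S₀bad : Finset (HeightOneSpectrum (𝓞 ↥(maximalRealSubfield L)))) : Prop :=
  ∀ (v : HeightOneSpectrum (𝓞 ↥(maximalRealSubfield L))) (hv : v ∉ S), v ∉ S₀bad → T'.loc v = T.loc v ∘ (ψ v hv).symm

/-- Unfolding of `LocalTransferAwayOff`. [cite: Rogawski1990, §14.2 p. 233] -/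
theorem localTransferAwayOff_iff {H H' : Matrix (Fin N) (Fin N) L} (S : Finset (HeightOneSpectrum (𝓞 ↥(maximalRealSubfield L))))
    (ψ : ∀ v : HeightOneSpectrum (𝓞 ↥(maximalRealSubfield L)), v ∉ S → ((cmDatum L N H).Local v ≃ₜ* (cmDatum L N H').Local v))
    (T : PureTensor L N H) (T' : PureTensor L N H') (S₀bad : Finset (HeightOneSpectrum (𝓞 ↥(maximalRealSubfield L)))) :
    LocalTransferAwayOff L N S ψ T T' S₀bad ↔
      ∀ (v : HeightOneSpectrum (𝓞 ↥(maximalRealSubfield L))) (hv : v ∉ S), v ∉ S₀bad → ∀ k, T'.loc v k = T.loc v ((ψ v hv).symm k) := by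
  simp only [LocalTransferAwayOff, funext_iff, Function.comp_apply]

/-- **`S = ∅` recovers the total-family relation** ★ `LocalTransferAway`. [cite: Rogawski1990, §14.2 p. 233] -/
theorem localTransferAwayOff_empty_iff {H H' : Matrix (Fin N) (Fin N) L}
    (ψ : ∀ v : HeightOneSpectrum (𝓞 ↥(maximalRealSubfield L)), (cmDatum L N H).Local v ≃ₜ* (cmDatum L N H').Local v)
    (T : PureTensor L N H) (T' : PureTensor L N H') (S₀bad : Finset (HeightOneSpectrum (𝓞 ↥(maximalRealSubfield L)))) :
    LocalTransferAwayOff L N ∅ (fun v _ => ψ v) T T' S₀bad ↔ LocalTransferAway L N ψ T T' S₀bad :=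
  ⟨fun h v hv => h v (Finset.notMem_empty v) hv, fun h v _ hv => h v hv⟩

/-- **`GlobalTransferAwayOff S ψ S₀ f′ f`** — `f′ ∈ C_c(U(H)(𝔸_{L⁺}))` and `f ∈ C_c(U(H′)(𝔸_{L⁺}))` are pure tensors `T`, `T′` matching along the
identifications `ψ v hv` (`v ∉ S`) away from `S₀` and their own bad sets: `∃ T T′`, `f′ = T.eval`, `f = T′.eval`,
`LocalTransferAwayOff S ψ T T′ (S₀ ∪ T.S ∪ T′.S)`.  Rank-generic twin of ★ `GlobalTransferAway` for identifications that exist only off `S` (rank 2: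
`S ⊇ T`, §3). [cite: Rogawski1990, §14.2 p. 233] -/
def GlobalTransferAwayOff {H H' : Matrix (Fin N) (Fin N) L} (S : Finset (HeightOneSpectrum (𝓞 ↥(maximalRealSubfield L))))
    (ψ : ∀ v : HeightOneSpectrum (𝓞 ↥(maximalRealSubfield L)), v ∉ S → ((cmDatum L N H).Local v ≃ₜ* (cmDatum L N H').Local v))
    (S₀ : Finset (HeightOneSpectrum (𝓞 ↥(maximalRealSubfield L))))
    (f' : CompactlySupportedContinuousMap (cmDatum L N H).Adelic ℂ)
    (f : CompactlySupportedContinuousMap (cmDatum L N H').Adelic ℂ) : Prop :=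
  ∃ (T : PureTensor L N H) (T' : PureTensor L N H'), ⇑f' = T.eval ∧ ⇑f = T'.eval ∧
    LocalTransferAwayOff L N S ψ T T' (S₀ ∪ T.S ∪ T'.S)

/-- Unfolding of `GlobalTransferAwayOff`. [cite: Rogawski1990, §14.2 p. 233] -/
theorem globalTransferAwayOff_iff {H H' : Matrix (Fin N) (Fin N) L} (S : Finset (HeightOneSpectrum (𝓞 ↥(maximalRealSubfield L))))
    (ψ : ∀ v : HeightOneSpectrum (𝓞 ↥(maximalRealSubfield L)), v ∉ S → ((cmDatum L N H).Local v ≃ₜ* (cmDatum L N H').Local v))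
    (S₀ : Finset (HeightOneSpectrum (𝓞 ↥(maximalRealSubfield L))))
    (f' : CompactlySupportedContinuousMap (cmDatum L N H).Adelic ℂ)
    (f : CompactlySupportedContinuousMap (cmDatum L N H').Adelic ℂ) :
    GlobalTransferAwayOff L N S ψ S₀ f' f ↔
      ∃ (T : PureTensor L N H) (T' : PureTensor L N H'), ⇑f' = T.eval ∧ ⇑f = T'.eval ∧
        ∀ (v : HeightOneSpectrum (𝓞 ↥(maximalRealSubfield L))) (hv : v ∉ S), v ∉ S₀ ∪ T.S ∪ T'.S →
          T'.loc v = T.loc v ∘ (ψ v hv).symm :=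
  Iff.rfl

/-- **`S = ∅` recovers ★ `GlobalTransferAway`** (so the rank-3 line, which has a total `ψ`, reads either object). [cite: Rogawski1990, §14.2 p. 233] -/
theorem globalTransferAwayOff_empty_iff {H H' : Matrix (Fin N) (Fin N) L}
    (ψ : ∀ v : HeightOneSpectrum (𝓞 ↥(maximalRealSubfield L)), (cmDatum L N H).Local v ≃ₜ* (cmDatum L N H').Local v)
    (S₀ : Finset (HeightOneSpectrum (𝓞 ↥(maximalRealSubfield L))))
    (f' : CompactlySupportedContinuousMap (cmDatum L N H).Adelic ℂ)
    (f : CompactlySupportedContinuousMap (cmDatum L N H').Adelic ℂ) :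
    GlobalTransferAwayOff L N ∅ (fun v _ => ψ v) S₀ f' f ↔ GlobalTransferAway L N ψ S₀ f' f := by
  refine ⟨fun ⟨T, T', hf', hf, h⟩ => ⟨T, T', hf', hf, (localTransferAwayOff_empty_iff L N ψ T T' _).1 h⟩,
    fun ⟨T, T', hf', hf, h⟩ => ⟨T, T', hf', hf, (localTransferAwayOff_empty_iff L N ψ T T' _).2 h⟩⟩

/-- Shrinking the domain of the identifications: a relation along `ψ` off `S` restricts to one along `ψ|` off any `S' ⊇ S`.
[cite: Rogawski1990, §14.2 p. 233] -/
theorem LocalTransferAwayOff.mono {H H' : Matrix (Fin N) (Fin N) L} {S S' : Finset (HeightOneSpectrum (𝓞 ↥(maximalRealSubfield L)))}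
    (hSS' : S ⊆ S')
    {ψ : ∀ v : HeightOneSpectrum (𝓞 ↥(maximalRealSubfield L)), v ∉ S → ((cmDatum L N H).Local v ≃ₜ* (cmDatum L N H').Local v)}
    {T : PureTensor L N H} {T' : PureTensor L N H'} {S₀bad : Finset (HeightOneSpectrum (𝓞 ↥(maximalRealSubfield L)))}
    (h : LocalTransferAwayOff L N S ψ T T' S₀bad) :
    LocalTransferAwayOff L N S' (fun v hv => ψ v fun h' => hv (hSS' h')) T T' S₀bad :=
  fun v hv hv₀ => h v (fun h' => hv (hSS' h')) hv₀

/-! ## §2 (N) Non-vacuity: the unit tensors match along level-matching identifications off `S ∪ S₀` -/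

/-- **(N) Non-vacuity of `GlobalTransferAwayOff`.**  If for `v ∉ S`, `v ∉ S₀` the identification `ψ v hv` matches the integral levels
(`ψ v hv g ∈ U(H′)(𝒪_v) ↔ g ∈ U(H)(𝒪_v)`), then some `f′ ≠ 0` in `C_c(U(H)(𝔸))` is related to some `f`: the unit tensors `φ_∞ ⊗ ⊗_v 1_{U(H)(𝒪_v)}`,
`φ′_∞ ⊗ ⊗_v 1_{U(H′)(𝒪_v)}` (archimedean Urysohn bumps with `φ(1) = 1`, ★ `exists_arch_bump`, ★ `PureTensor.unit`) — twin of ★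
`exists_globalTransferAway_ne_zero`. [cite: Rogawski1990, §14.2 p. 233] -/
theorem exists_globalTransferAwayOff_ne_zero {H H' : Matrix (Fin N) (Fin N) L} (S : Finset (HeightOneSpectrum (𝓞 ↥(maximalRealSubfield L))))
    (ψ : ∀ v : HeightOneSpectrum (𝓞 ↥(maximalRealSubfield L)), v ∉ S → ((cmDatum L N H).Local v ≃ₜ* (cmDatum L N H').Local v))
    (S₀ : Finset (HeightOneSpectrum (𝓞 ↥(maximalRealSubfield L))))
    (hψ : ∀ (v : HeightOneSpectrum (𝓞 ↥(maximalRealSubfield L))) (hv : v ∉ S), v ∉ S₀ →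
      ∀ g, ψ v hv g ∈ cmLocalIntegralLevel L N H' v ↔ g ∈ cmLocalIntegralLevel L N H v) :
    ∃ (f' : CompactlySupportedContinuousMap (cmDatum L N H).Adelic ℂ)
      (f : CompactlySupportedContinuousMap (cmDatum L N H').Adelic ℂ), f' ≠ 0 ∧ GlobalTransferAwayOff L N S ψ S₀ f' f := by
  classical
  obtain ⟨φ, hφ, hφc, hφ1⟩ := exists_arch_bump L H
  obtain ⟨φ', hφ', hφ'c, -⟩ := exists_arch_bump L H'
  let T : PureTensor L N H := PureTensor.unit L H fun g => (φ g : ℂ)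
  let T' : PureTensor L N H' := PureTensor.unit L H' fun g => (φ' g : ℂ)
  have hK : ∀ v ∉ T.S, T.K v = cmLocalIntegralLevel L N H v := fun _ _ => rfl
  have hK' : ∀ v ∉ T'.S, T'.K v = cmLocalIntegralLevel L N H' v := fun _ _ => rfl
  have ha : Continuous T.arch := Complex.continuous_ofReal.comp hφ
  have ha' : Continuous T'.arch := Complex.continuous_ofReal.comp hφ'
  have hac : HasCompactSupport T.arch := hφc.comp_left Complex.ofReal_zero
  have hac' : HasCompactSupport T'.arch := hφ'c.comp_left Complex.ofReal_zero
  have hl : ∀ v ∈ T.S, Continuous (T.loc v) := fun v hv => absurd hv (Finset.notMem_empty v)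
  have hl' : ∀ v ∈ T'.S, Continuous (T'.loc v) := fun v hv => absurd hv (Finset.notMem_empty v)
  have hlc : ∀ v ∈ T.S, HasCompactSupport (T.loc v) := fun v hv => absurd hv (Finset.notMem_empty v)
  have hlc' : ∀ v ∈ T'.S, HasCompactSupport (T'.loc v) := fun v hv => absurd hv (Finset.notMem_empty v)
  refine ⟨T.toCc hK ha hac hl hlc, T'.toCc hK' ha' hac' hl' hlc', fun h0 => ?_, T, T', rfl, rfl, fun v hvS hv => ?_⟩
  · -- `f′(1) = φ(1) = 1 ≠ 0`
    have h1 : T.eval 1 = 1 := by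
      rw [show T = PureTensor.unit L H fun g => (φ g : ℂ) from rfl, PureTensor.unit_eval_one, hφ1, Complex.ofReal_one]
    have h := DFunLike.congr_fun h0 (1 : (cmDatum L N H).Adelic)
    rw [PureTensor.toCc_apply, CompactlySupportedContinuousMap.zero_apply, h1] at h
    exact one_ne_zero h
  · -- the matching `1_{U(H′)(𝒪_v)} = 1_{U(H)(𝒪_v)} ∘ (ψ v hv)⁻¹` for `v ∉ S`, `v ∉ S₀`
    have hv₀ : v ∉ S₀ := by
      simp only [Finset.union_empty, show T.S = ∅ from rfl, show T'.S = ∅ from rfl] at hv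
      exact hv
    funext k'
    change ((cmLocalIntegralLevel L N H' v : Set ((cmDatum L N H').Local v))).indicator (fun _ => (1 : ℂ)) k' =
      ((cmLocalIntegralLevel L N H v : Set ((cmDatum L N H).Local v))).indicator (fun _ => (1 : ℂ)) ((ψ v hvS).symm k')
    by_cases hk : k' ∈ cmLocalIntegralLevel L N H' v
    · have hk' : (ψ v hvS).symm k' ∈ cmLocalIntegralLevel L N H v :=
        (hψ v hvS hv₀ _).1 (by rw [ContinuousMulEquiv.apply_symm_apply]; exact hk)
      rw [Set.indicator_of_mem (show k' ∈ (cmLocalIntegralLevel L N H' v : Set _) from hk),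
        Set.indicator_of_mem (show (ψ v hvS).symm k' ∈ (cmLocalIntegralLevel L N H v : Set _) from hk')]
    · have hk' : (ψ v hvS).symm k' ∉ cmLocalIntegralLevel L N H v := fun h =>
        hk (by have h' := (hψ v hvS hv₀ _).2 h; rwa [ContinuousMulEquiv.apply_symm_apply] at h')
      rw [Set.indicator_of_notMem (show k' ∉ (cmLocalIntegralLevel L N H' v : Set _) from hk),
        Set.indicator_of_notMem (show (ψ v hvS).symm k' ∉ (cmLocalIntegralLevel L N H v : Set _) from hk')]

/-! ## §3 (Ψ₂) The rank-2 supply: one family `ψ` off the anisotropic set `T`, conjugation everywhere, level matching off `S₀` -/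

/-- **(Ψ₂) For a hermitian `H ∈ M₂(L)` with `det H ≠ 0`: ONE family of local identifications `ψ v hv : U(H)(L⁺_v) ≃ₜ* U(Φ₂)(L⁺_v)` defined at
every place OFF the finite anisotropic set `T` (returned as a `Finset` `S`, `v ∈ S ↔ v ∈ T`), each a CONJUGATION `g ↦ S_v⁻¹ g S_v`
(`S_v ∈ GL₂(L ⊗ L⁺_v)`) — hence `γ′ ↔ ψ_v γ′` and `ψ_v⁻¹ γ ↔ γ` (★ `Rogawski1990.Corresponds`) — and matching the integral levels
`ψ_v g ∈ U(Φ₂)(𝒪_v) ↔ g ∈ U(H)(𝒪_v)` off a finite `S₀ ⊇ S`.**  [Rogawski1990, §14.2 pp. 232–233] read in rank 2 ([§3.8 p. 30]: at `v ∈ T` the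
group `U(H)(L⁺_v)` is compact and no `ψ_v` exists, ★ `isEmpty_cmDatum_local_equiv_antidiagTwo_of_not_isIsotropic`).  Glued by cases from ★
`exists_finset_rankTwo_levelMatching` (as ★ `exists_psi_conj_forall_levelMatching` glues in rank 3). [cite: Rogawski1990, §14.2 p. 233]
[cite: Rogawski1990, §3.8 p. 30] -/
theorem exists_psiOff_conj_forall_levelMatching_two (H : Matrix (Fin 2) (Fin 2) L)
    (hH : (H.map (cmConjRingHom L))ᵀ = H) (hHd : H.det ≠ 0) {δ : L} (hcδ : IsCMField.complexConj L δ = -δ) (hδ : δ ≠ 0) :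
    ∃ (S : Finset (HeightOneSpectrum (𝓞 ↥(maximalRealSubfield L))))
      (ψ : ∀ v : HeightOneSpectrum (𝓞 ↥(maximalRealSubfield L)), v ∉ S → ((cmDatum L 2 H).Local v ≃ₜ*
        (cmDatum L 2 (Matrix.of fun i j : Fin 2 => if i.val + j.val + 1 = 2 then (1 : L) else 0)).Local v))
      (S₀ : Finset (HeightOneSpectrum (𝓞 ↥(maximalRealSubfield L)))),
      (∀ v, v ∈ S ↔ ¬ Liu2021.LemD1.IsIsotropic (Liu2021.LemD1OfPlace.standingData L v (IsCMField.complexConj L) 2 H hcδ hδ le_rfl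
        ((map_cmConjRingHom_eq_map_complexConj L H) ▸ hH) hHd)) ∧
      S ⊆ S₀ ∧
      (∀ v (hv : v ∉ S), ∃ Sv : GL (Fin 2) (LocalRing L v), ∀ g : (cmDatum L 2 H).Local v,
        ((ψ v hv g).val : GL (Fin 2) (LocalRing L v)) = Sv⁻¹ * g.val * Sv) ∧
      (∀ v (hv : v ∉ S) (γ' : (cmDatum L 2 H).Local v),
        Corresponds (conjLocal L (IsCMField.complexConj L) v) ((adelicForm L 2 H).map (adeleToLocal L v))
          ((adelicForm L 2 (Matrix.of fun i j : Fin 2 => if i.val + j.val + 1 = 2 then (1 : L) else 0)).map (adeleToLocal L v))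
          γ' (ψ v hv γ')) ∧
      (∀ v (hv : v ∉ S) (γ : (cmDatum L 2 (Matrix.of fun i j : Fin 2 => if i.val + j.val + 1 = 2 then (1 : L) else 0)).Local v),
        Corresponds (conjLocal L (IsCMField.complexConj L) v) ((adelicForm L 2 H).map (adeleToLocal L v))
          ((adelicForm L 2 (Matrix.of fun i j : Fin 2 => if i.val + j.val + 1 = 2 then (1 : L) else 0)).map (adeleToLocal L v))
          ((ψ v hv).symm γ) γ) ∧
      ∀ v (hv : v ∉ S), v ∉ S₀ → ∀ g,
        ψ v hv g ∈ cmLocalIntegralLevel L 2 (Matrix.of fun i j : Fin 2 => if i.val + j.val + 1 = 2 then (1 : L) else 0) v ↔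
          g ∈ cmLocalIntegralLevel L 2 H v := by
  classical
  have hT := finite_setOf_not_isIsotropic_standingData L H hH hHd le_rfl hcδ hδ
  obtain ⟨S₀, hTS₀, hoff, hiso⟩ := exists_finset_rankTwo_levelMatching L H hH hHd hcδ hδ
  -- the two per-place supplies: `P v` (conjugation + correspondence + level matching, off `S₀`) and `Q v` (conjugation + correspondence, off `T`)
  let P : ∀ v : HeightOneSpectrum (𝓞 ↥(maximalRealSubfield L)), ((cmDatum L 2 H).Local v ≃ₜ*
      (cmDatum L 2 (Matrix.of fun i j : Fin 2 => if i.val + j.val + 1 = 2 then (1 : L) else 0)).Local v) → Prop := fun v ψ =>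
    (∃ Sv : GL (Fin 2) (LocalRing L v), ∀ g : (cmDatum L 2 H).Local v, ((ψ g).val : GL (Fin 2) (LocalRing L v)) = Sv⁻¹ * g.val * Sv) ∧
    (∀ γ' : (cmDatum L 2 H).Local v,
      Corresponds (conjLocal L (IsCMField.complexConj L) v) ((adelicForm L 2 H).map (adeleToLocal L v))
        ((adelicForm L 2 (Matrix.of fun i j : Fin 2 => if i.val + j.val + 1 = 2 then (1 : L) else 0)).map (adeleToLocal L v))
        γ' (ψ γ')) ∧
    (∀ γ : (cmDatum L 2 (Matrix.of fun i j : Fin 2 => if i.val + j.val + 1 = 2 then (1 : L) else 0)).Local v,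
      Corresponds (conjLocal L (IsCMField.complexConj L) v) ((adelicForm L 2 H).map (adeleToLocal L v))
        ((adelicForm L 2 (Matrix.of fun i j : Fin 2 => if i.val + j.val + 1 = 2 then (1 : L) else 0)).map (adeleToLocal L v))
        (ψ.symm γ) γ) ∧
    ∀ g, ψ g ∈ cmLocalIntegralLevel L 2 (Matrix.of fun i j : Fin 2 => if i.val + j.val + 1 = 2 then (1 : L) else 0) v ↔
      g ∈ cmLocalIntegralLevel L 2 H v
  have hQ : ∀ v, v ∉ hT.toFinset → ∃ ψ : (cmDatum L 2 H).Local v ≃ₜ*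
      (cmDatum L 2 (Matrix.of fun i j : Fin 2 => if i.val + j.val + 1 = 2 then (1 : L) else 0)).Local v,
      (∃ Sv : GL (Fin 2) (LocalRing L v), ∀ g : (cmDatum L 2 H).Local v, ((ψ g).val : GL (Fin 2) (LocalRing L v)) = Sv⁻¹ * g.val * Sv) ∧
      (∀ γ' : (cmDatum L 2 H).Local v,
        Corresponds (conjLocal L (IsCMField.complexConj L) v) ((adelicForm L 2 H).map (adeleToLocal L v))
          ((adelicForm L 2 (Matrix.of fun i j : Fin 2 => if i.val + j.val + 1 = 2 then (1 : L) else 0)).map (adeleToLocal L v))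
          γ' (ψ γ')) ∧
      ∀ γ : (cmDatum L 2 (Matrix.of fun i j : Fin 2 => if i.val + j.val + 1 = 2 then (1 : L) else 0)).Local v,
        Corresponds (conjLocal L (IsCMField.complexConj L) v) ((adelicForm L 2 H).map (adeleToLocal L v))
          ((adelicForm L 2 (Matrix.of fun i j : Fin 2 => if i.val + j.val + 1 = 2 then (1 : L) else 0)).map (adeleToLocal L v))
          (ψ.symm γ) γ := by
    intro v hv
    rw [Set.Finite.mem_toFinset] at hv
    obtain ⟨Tv, e, hconj, hcorr, hcorr'⟩ := hiso v (not_not.1 hv)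
    exact ⟨e, ⟨Tv, hconj⟩, hcorr, hcorr'⟩
  refine ⟨hT.toFinset, fun v hv => if h : ∃ ψ, P v ψ then h.choose else (hQ v hv).choose, S₀, fun v => ?_, fun v hv => ?_,
    fun v hv => ?_, fun v hv γ' => ?_, fun v hv γ => ?_, fun v hv hv₀ g => ?_⟩
  · rw [Set.Finite.mem_toFinset]
    rfl
  · rw [Set.Finite.mem_toFinset] at hv
    exact hTS₀ hv
  · by_cases h : ∃ ψ, P v ψ
    · simp only [dif_pos h]
      exact h.choose_spec.1
    · simp only [dif_neg h]
      exact (hQ v hv).choose_spec.1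
  · by_cases h : ∃ ψ, P v ψ
    · simp only [dif_pos h]
      exact h.choose_spec.2.1 γ'
    · simp only [dif_neg h]
      exact (hQ v hv).choose_spec.2.1 γ'
  · by_cases h : ∃ ψ, P v ψ
    · simp only [dif_pos h]
      exact h.choose_spec.2.2.1 γ
    · simp only [dif_neg h]
      exact (hQ v hv).choose_spec.2.2 γ
  · have h : ∃ ψ, P v ψ := hoff v hv₀
    simp only [dif_pos h]
    exact h.choose_spec.2.2.2 g

/-- **With the family (Ψ₂), `GlobalTransferAwayOff` is non-vacuous in rank 2**: for `H ∈ M₂(L)` hermitian with `det H ≠ 0` there are `S` (`= T`),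
`ψ` off `S`, `S₀ ⊇ S` as in `exists_psiOff_conj_forall_levelMatching_two` and `f′ ≠ 0`, `f` with `GlobalTransferAwayOff S ψ S₀ f′ f` (§2).
[cite: Rogawski1990, §14.2 p. 233] -/
theorem exists_psiOff_globalTransferAwayOff_ne_zero_two (H : Matrix (Fin 2) (Fin 2) L)
    (hH : (H.map (cmConjRingHom L))ᵀ = H) (hHd : H.det ≠ 0) {δ : L} (hcδ : IsCMField.complexConj L δ = -δ) (hδ : δ ≠ 0) :
    ∃ (S : Finset (HeightOneSpectrum (𝓞 ↥(maximalRealSubfield L))))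
      (ψ : ∀ v : HeightOneSpectrum (𝓞 ↥(maximalRealSubfield L)), v ∉ S → ((cmDatum L 2 H).Local v ≃ₜ*
        (cmDatum L 2 (Matrix.of fun i j : Fin 2 => if i.val + j.val + 1 = 2 then (1 : L) else 0)).Local v))
      (S₀ : Finset (HeightOneSpectrum (𝓞 ↥(maximalRealSubfield L)))),
      (∀ v, v ∈ S ↔ ¬ Liu2021.LemD1.IsIsotropic (Liu2021.LemD1OfPlace.standingData L v (IsCMField.complexConj L) 2 H hcδ hδ le_rfl
        ((map_cmConjRingHom_eq_map_complexConj L H) ▸ hH) hHd)) ∧ S ⊆ S₀ ∧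
      (∀ v (hv : v ∉ S), v ∉ S₀ → ∀ g,
        ψ v hv g ∈ cmLocalIntegralLevel L 2 (Matrix.of fun i j : Fin 2 => if i.val + j.val + 1 = 2 then (1 : L) else 0) v ↔
          g ∈ cmLocalIntegralLevel L 2 H v) ∧
      ∃ (f' : CompactlySupportedContinuousMap (cmDatum L 2 H).Adelic ℂ)
        (f : CompactlySupportedContinuousMap
          (cmDatum L 2 (Matrix.of fun i j : Fin 2 => if i.val + j.val + 1 = 2 then (1 : L) else 0)).Adelic ℂ),
        f' ≠ 0 ∧ GlobalTransferAwayOff L 2 S ψ S₀ f' f := by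
  obtain ⟨S, ψ, S₀, hS, hSS₀, -, -, -, hlev⟩ := exists_psiOff_conj_forall_levelMatching_two L H hH hHd hcδ hδ
  exact ⟨S, ψ, S₀, hS, hSS₀, hlev, exists_globalTransferAwayOff_ne_zero L 2 S ψ S₀ hlev⟩

end Literature.NumberTheory.Automorphic.UnitaryGroup

end
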